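import Literature.NumberTheory.EllipticCurves.PastenValuationProductThm75Proofs
import Literature.NumberTheory.EllipticCurves.PastenCongruenceModulusProofs
import Literature.NumberTheory.EllipticCurves.PastenCongruenceModulusSizeProofs
import Literature.NumberTheory.EllipticCurves.ModularCurveSturmProofs
import HarnessLib

/-!
# Pasten, *Shimura curves and the abc conjecture*, Thm 7.5 — the EXPLICIT discriminant clause,
# reduced to its printed inputs

Topic `NumberTheory/EllipticCurves`; namespace `Literature.NumberTheory.EllipticCurves` (helpers in
the sub-namespace `….Pasten2024`, as in the sibling `PastenValuationProductThm75Proofs.lean`).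
A proofs-only companion (theorems only: NO definition, NO new named fact, nothing restated;
D-0026) of the named fact `pasten_thm_7_5_explicit` of
`Literature/NumberTheory/EllipticCurves/PastenValuationProduct.lean`:
*"For all elliptic curves `E` over `ℚ` of conductor `N` we have
`log|Δ_E| ≤ ½ (N + 7 d(N²)) (log N + 4 log N / log log N) + 124`"* — H. Pasten, J. Number Theory
254 (2024) = arXiv:1705.09251, Thm 7.5 (p. 27 of the arXiv version), `d` = number of divisors.

## The printed proof (arXiv:1705.09251, §3 p. 13, §7.1–7.2 p. 26, §7.4 p. 27) and this file

§7.4: "The classical modular approach to Szpiro's conjecture (Section 3, especially (EqDiscH)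
`log Δ_E ≤ 12 h(E) + 16` and (EqHDeg) `h(E) ≤ ½ log δ_{1,N} + 9`) together with our bounds for
`δ_{D,M}` specialized to `D = 1`, `M = N`, give Thm 7.5": `log Δ_E ≤ 6 log δ_{1,N} + 124` and
Thm 7.2 (explicit clause) `log δ_{1,N} ≤ (N/12 + (7/12) d(N²)) (log N + 4 log N / log log N)`.
In the tree:

* `log|Δ_min(W)| ≤ 6 log(minModularDegree W N_W) + (24π + 16 − 6 log π)` for a globally minimal
  `W`, from MODULARITY ALONE — PROVED in the sibling file
  (`Pasten2024.log_minimalDiscriminantNorm_le_of_modularity`: Silverman's (EqDiscH)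
  `pasten2024_log_minimalDiscriminant_le_holds`, Zagier's formula `zagier_degree_formula_holds`,
  `c ∈ ℤ ∖ {0}` and the trivial Petersson bound `IsNewformOf.peterssonProduct_re_ge`, all proved);
* `minModularDegree ≤ 163 · δ_{1,N}` (Pasten §3 p. 13, Mazur–Kenku) — the named fact
  `PastenShimura2024_minimalDegree_le_163_mul` (`PastenSpectralDegree.lean`); the printed `9` of
  (EqHDeg) is `6 + ½ log 163 < 9`, and here `6 log 163 + 24π + 16 − 6 log π < 119 ≤ 124`
  (`Pasten2024.six_log_163_add_const_le_124`);
* Thm 7.2, explicit clause, in Pasten's `δ_{1,N}` idiom of `PastenSpectralDegree.lean` (the degree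
  of a datum of minimal degree among all data at level `N` with the same newform) — NOT vendored in
  the tree; it is the hypothesis `hδ` of `pasten_thm_7_5_explicit_of_modularity_of_degreeBound`,
  and it is DERIVED here (`Pasten2024.log_modularDegree_le_of_thm_5_5`), exactly as on p. 26, from
  (i) Thm 5.5 `δ_{1,N} ∣ ∏_{[χ] ≠ [χ₀]} η_{[χ₀]}([χ])` (named fact `PastenShimura2024_thm_5_5`),
  (ii) the displayed size bound `log η_{[χ₀]}(c) < #c (log N + 4 log N / log log N)` (`N ≥ 11`;
  the bare hypothesis `hη`, which the tree PROVES from the weight-`2` case of Deligne's bound —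
  `PastenShimura2024_log_heckeCongruenceModulus_lt_of_deligne` of
  `PastenCongruenceModulusSizeProofs.lean`, whose only unproved input is the named fact
  `Deligne1974_heckeT_eigenvalue_norm_le`; formerly a separate named fact of
  `PastenSpectralDegree.lean`, merged here after the D-0027 review of 2026-08-15), and (iii)
  Prop 7.1 in the form it is used on p. 26, `Σ_{c ≠ [χ₀]} #c = r_{1,N} − 1 ≤ N/12 + (7/12) d(N²)`
  (G. Martin's dimension bound; NOT in the tree — the hypothesis `hr`, with `#c` read, as in (ii),
  as the `ℤ`-rank of `𝕋 ⧸ 𝕀_c`);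
* `N ≥ 11` for a level carrying a datum (`Pasten2024.eleven_le_level`: `S₂(Γ₀(N)) = 0` for
  `N ≤ 10`, the tree's PROVED `cuspForm_two_gamma0_eq_zero_of_le_ten`), which also makes
  `log N + 4 log N / log log N ≥ 0`;
* modularity with an integral Manin constant — the named fact `nonempty_modularParametrizationData`
  (Wiles, Taylor–Wiles, Breuil–Conrad–Diamond–Taylor; Edixhoven), the only input of
  `pasten_thm_7_5_explicit` that is neither proved nor a vendored statement of [PastenShimura2024];
* passage to a global minimal model `C • W` (`hasGlobalMinimalModel_rat_holds`,
  `conductorNorm_smul_rat`, `minimalDiscriminantNorm_smul_rat`), as in the sibling file.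

## Status of `pasten_thm_7_5_explicit`

`pasten_thm_7_5_explicit_holds` is NOT here: it needs the Modularity Theorem (and Deligne's bound in
weight `2`, and Prop 7.1). This file proves `pasten_thm_7_5_explicit` from
`nonempty_modularParametrizationData`, the Mazur–Kenku fact and Thm 7.2 (explicit, `hδ`) —
`pasten_thm_7_5_explicit_of_modularity_of_degreeBound` — and, unfolding Thm 7.2 as printed, from
the named facts `nonempty_modularParametrizationData`, `PastenShimura2024_minimalDegree_le_163_mul`,
`PastenShimura2024_thm_5_5`, `Deligne1974_heckeT_eigenvalue_norm_le` (through the proved size bound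
`PastenShimura2024_log_heckeCongruenceModulus_lt_of_deligne`) and Prop 7.1 (`hr`) —
`pasten_thm_7_5_explicit_of_modularity_of_thm_5_5` (the intermediate Thm 7.2-with-slot form of that
composition is `Pasten2024.log_modularDegree_le_of_thm_5_5_of_deligne`, at the end of the file).

## References

* H. Pasten, *Shimura curves and the abc conjecture*, J. Number Theory 254 (2024) 214–335,
  arXiv:1705.09251: §3 p. 13 ((EqDiscH), (EqFrey), (EqHDeg)), Prop 7.1 and Thm 7.2 with its proof
  (p. 26), §7.4 Thm 7.5 (p. 27). [PastenShimura2024]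
* P. Deligne, *La conjecture de Weil. I*, Publ. Math. IHÉS 43 (1974), 273–307, Thm. 8.2 (p. 302).
  [Deligne1974]
-/

noncomputable section

open WeierstrassCurve CongruenceSubgroup

namespace Literature.NumberTheory.EllipticCurves

open ModularForms

namespace Pasten2024

/-! ### Numerical constants -/

/-- `1 ≤ log π` (as `e < 2.72 < 3 < π`). [folklore] -/
theorem one_le_log_pi : 1 ≤ Real.log Real.pi := by
  rw [Real.le_log_iff_exp_le Real.pi_pos]
  have h1 := Real.exp_one_lt_d9
  have h2 := Real.pi_gt_three
  linarith

/-- `6 log 163 ≤ 48 log 2 < 33.28` (`163 ≤ 256 = 2⁸`). [folklore] -/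
theorem six_mul_log_163_lt : 6 * Real.log 163 < 33.28 := by
  have h1 : Real.log 163 ≤ Real.log 256 := Real.log_le_log (by norm_num) (by norm_num)
  have h2 : Real.log 256 = 8 * Real.log 2 := by
    rw [show (256 : ℝ) = 2 ^ 8 by norm_num, Real.log_pow]
    norm_num
  have h3 := Real.log_two_lt_d9
  linarith

/-- **The explicit constant.** `6 log 163 + (24π + 16 − 6 log π) ≤ 124`: the absolute constant of
`log_minimalDiscriminantNorm_le_of_modularity` (sibling file) plus six times the Mazur–Kenku
`log 163` stays below Pasten's printed `124 = 12 · 9 + 16` (indeed it is `< 119`; Pasten's `9` in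
(EqHDeg) is `6 + 3` with `½ log 163 < 3`). [cite: PastenShimura2024, §3 p. 13 and Thm 7.5] -/
theorem six_log_163_add_const_le_124 :
    6 * Real.log 163 + (24 * Real.pi + 16 - 6 * Real.log Real.pi) ≤ 124 := by
  have h1 := six_mul_log_163_lt
  have h2 := one_le_log_pi
  have h3 := Real.pi_lt_d2
  linarith

/-! ### A level carrying a datum is `≥ 11` -/

variable {W : WeierstrassCurve ℚ} {N : ℕ} [NeZero N]

/-- **`N ≥ 11` for every level carrying a modular parametrisation datum** (Pasten, proof of
Cor 5.3, p. 17: "as `N ≥ 11`"): the newform `D.f ∈ S₂(Γ₀(N))` is nonzero (`a₁ = 1`), while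
`S₂(Γ₀(N)) = 0` for `N ≤ 10` (genus-zero levels; the tree's `cuspForm_two_gamma0_eq_zero_of_le_ten`).
[cite: PastenShimura2024, proof of Cor. 5.3, p. 17] -/
theorem eleven_le_level (D : ModularParametrizationData W N) : 11 ≤ N := by
  by_contra h
  exact D.f_ne_zero (cuspForm_two_gamma0_eq_zero_of_le_ten (by omega) D.f)

/-- For `N ≥ 3 > e`: `log N > 1`, hence `log log N > 0`. [folklore] -/
theorem log_log_pos_of_three_le {N : ℕ} (hN : 3 ≤ N) : 0 < Real.log (Real.log N) := by
  apply Real.log_pos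
  rw [Real.lt_log_iff_exp_lt (by positivity)]
  have h1 := Real.exp_one_lt_d9
  have h2 : (3 : ℝ) ≤ N := by exact_mod_cast hN
  linarith

/-- Pasten's factor `log N + 4 log N / log log N` is nonnegative for `N ≥ 3`. [folklore] -/
theorem logFactor_nonneg {N : ℕ} (hN : 3 ≤ N) :
    0 ≤ Real.log N + 4 * Real.log N / Real.log (Real.log N) := by
  have h1 : 0 ≤ Real.log N := Real.log_natCast_nonneg N
  have h2 := log_log_pos_of_three_le hN
  positivity

/-! ### Thm 7.2 (explicit clause) from Thm 5.5, the size of the congruence moduli, and Prop 7.1 -/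

/-- **`log δ_{1,N} ≤ Σ_{[χ] ≠ [χ₀]} log η_{[χ₀]}([χ])`** (first display after "Varying `c`" in the
proof of Thm 7.2, p. 26): from Thm 5.5 `δ_{1,N} ∣ ∏ η` (the named fact `PastenShimura2024_thm_5_5`,
hypothesis `h55`) and the positivity of every `η_{[χ₀]}(P)` (`prod_heckeCongruenceModulus_pos`,
proved), for a datum `D` of minimal degree in its class at level `N` (`D.modularDegree = δ_{1,N}`).
[cite: PastenShimura2024, proof of Thm. 7.2, p. 26] -/
theorem log_modularDegree_le_sum_log_heckeCongruenceModulus (h55 : PastenShimura2024_thm_5_5)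
    [W.IsElliptic] (D : ModularParametrizationData W N)
    (hmin : ∀ (W' : WeierstrassCurve ℚ) [W'.IsElliptic] (D' : ModularParametrizationData W' N),
      D'.f = D.f → D.modularDegree ≤ D'.modularDegree) :
    Real.log (D.modularDegree : ℝ) ≤
      ∑ P ∈ (finite_minimalPrimes_anemicHeckeRing N 2).toFinset.erase (eigenIdeal D.f),
        Real.log (heckeCongruenceModulus D.f P : ℝ) := by
  have hdvd := h55 N W D hmin
  have hpos := D.prod_heckeCongruenceModulus_pos
  have hle : D.modularDegree ≤
      ∏ P ∈ (finite_minimalPrimes_anemicHeckeRing N 2).toFinset.erase (eigenIdeal D.f),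
        heckeCongruenceModulus D.f P := Nat.le_of_dvd hpos hdvd
  have hdeg : (0 : ℝ) < D.modularDegree := by exact_mod_cast D.deg_pos
  have hle' : (D.modularDegree : ℝ) ≤
      ∏ P ∈ (finite_minimalPrimes_anemicHeckeRing N 2).toFinset.erase (eigenIdeal D.f),
        (heckeCongruenceModulus D.f P : ℝ) := by exact_mod_cast hle
  have hne : ∀ P ∈ (finite_minimalPrimes_anemicHeckeRing N 2).toFinset.erase (eigenIdeal D.f),
      (heckeCongruenceModulus D.f P : ℝ) ≠ 0 := fun P hP => by
    exact_mod_cast D.heckeCongruenceModulus_ne_zero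
      ((finite_minimalPrimes_anemicHeckeRing N 2).mem_toFinset.mp (Finset.mem_of_mem_erase hP))
      (Finset.ne_of_mem_erase hP)
  calc Real.log (D.modularDegree : ℝ)
      ≤ Real.log (∏ P ∈ (finite_minimalPrimes_anemicHeckeRing N 2).toFinset.erase (eigenIdeal D.f),
          (heckeCongruenceModulus D.f P : ℝ)) := Real.log_le_log hdeg hle'
    _ = _ := Real.log_prod hne

/-- **Thm 7.2, explicit clause, from its printed inputs** (proof on p. 26): for a datum `D` of
minimal degree in its class at level `N` (so `D.modularDegree = δ_{1,N}`),
`log δ_{1,N} ≤ (N/12 + (7/12) d(N²)) (log N + 4 log N / log log N)`, assuming (i) Thm 5.5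
(`h55 : PastenShimura2024_thm_5_5`), (ii) the size bound `log η_{[χ₀]}(c) < #c (log N + 4 log N / log log N)`
for every class `c ≠ [χ₀]` and `N ≥ 11` (`hη`, "So we get …", p. 26 — proved in the tree from
Deligne's bound in weight `2`, `PastenShimura2024_log_heckeCongruenceModulus_lt_of_deligne`; the
`N ≥ 11` is `eleven_le_level`), and (iii) `hr`, Prop 7.1 as used on p. 26 — "`< (r_{D,M} − 1)(…)` … here we used
`r_{D,M} = Σ_c #c` … By Prop 7.1 we obtain the claimed explicit bound" — i.e.
`Σ_{c ≠ [χ₀]} #c ≤ N/12 + (7/12) d(N²)` (`r_{1,N} ≤ N/12 + (7/12) d(N²) + 1`, `#[χ₀] = 1`), with the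
classes `c ≠ [χ₀]` read as the minimal primes `P ≠ 𝕀_{[χ₀]}` of `𝕋 = anemicHeckeRing N 2` and `#c`
as the `ℤ`-rank of `𝕋 ⧸ P` (the reading of `PastenSpectralDegree.lean`; Prop 7.1 rests on
G. Martin's `dim S₂(n)^{new} ≤ φ(n)/12 + (7/12) 2^{ω(n)} + μ(n)`, not in the tree). Printed with
`<` in the middle; the end result is Thm 7.2's `≤`. [cite: PastenShimura2024, Thm. 7.2 (proof, p. 26)] -/
theorem log_modularDegree_le_of_thm_5_5 (h55 : PastenShimura2024_thm_5_5)
    (hη : ∀ (N : ℕ) [NeZero N] (W : WeierstrassCurve ℚ) [W.IsElliptic]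
      (D : ModularParametrizationData W N), 11 ≤ N →
        ∀ P ∈ minimalPrimes (anemicHeckeRing N 2), P ≠ eigenIdeal D.f →
          Real.log (heckeCongruenceModulus D.f P) <
            (Module.finrank ℤ (anemicHeckeRing N 2 ⧸ P) : ℝ) *
              (Real.log N + 4 * Real.log N / Real.log (Real.log N)))
    (hr : ∀ (N : ℕ) [NeZero N] (W : WeierstrassCurve ℚ) [W.IsElliptic]
      (D : ModularParametrizationData W N),
      (∑ P ∈ (finite_minimalPrimes_anemicHeckeRing N 2).toFinset.erase (eigenIdeal D.f),
          (Module.finrank ℤ (anemicHeckeRing N 2 ⧸ P) : ℝ)) ≤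
        (N : ℝ) / 12 + 7 / 12 * ((N ^ 2).divisors.card : ℝ))
    [W.IsElliptic] (D : ModularParametrizationData W N)
    (hmin : ∀ (W' : WeierstrassCurve ℚ) [W'.IsElliptic] (D' : ModularParametrizationData W' N),
      D'.f = D.f → D.modularDegree ≤ D'.modularDegree) :
    Real.log (D.modularDegree : ℝ) ≤
      ((N : ℝ) / 12 + 7 / 12 * ((N ^ 2).divisors.card : ℝ)) *
        (Real.log N + 4 * Real.log N / Real.log (Real.log N)) := by
  have h11 : 11 ≤ N := eleven_le_level D
  have hX : 0 ≤ Real.log N + 4 * Real.log N / Real.log (Real.log N) :=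
    logFactor_nonneg (le_trans (by norm_num) h11)
  have h1 := log_modularDegree_le_sum_log_heckeCongruenceModulus h55 D hmin
  have h2 : ∑ P ∈ (finite_minimalPrimes_anemicHeckeRing N 2).toFinset.erase (eigenIdeal D.f),
        Real.log (heckeCongruenceModulus D.f P : ℝ) ≤
      ∑ P ∈ (finite_minimalPrimes_anemicHeckeRing N 2).toFinset.erase (eigenIdeal D.f),
        (Module.finrank ℤ (anemicHeckeRing N 2 ⧸ P) : ℝ) *
          (Real.log N + 4 * Real.log N / Real.log (Real.log N)) := by
    refine Finset.sum_le_sum fun P hP => le_of_lt (hη N W D h11 P ?_ ?_)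
    · exact (finite_minimalPrimes_anemicHeckeRing N 2).mem_toFinset.mp (Finset.mem_of_mem_erase hP)
    · exact Finset.ne_of_mem_erase hP
  rw [← Finset.sum_mul] at h2
  have h3 := mul_le_mul_of_nonneg_right (hr N W D) hX
  linarith

/-! ### Thm 7.5, explicit discriminant clause -/

/-- **From `δ_{1,N}` to the minimal modular degree of a globally minimal model, `≤` form** (Pasten
§3 p. 13, Mazur–Kenku; the named fact `PastenShimura2024_minimalDegree_le_163_mul`): a bound
`log δ_{1,N} ≤ B` for the data of minimal degree in the class at level `N_W` gives
`log(minModularDegree W N_W) ≤ log 163 + B` for a globally minimal elliptic `W` with a datum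
(the sibling's `log_minModularDegree_le_of_class_bound` with `≤` in place of `<`).
[cite: PastenShimura2024, §3 p. 13] -/
theorem log_minModularDegree_le_log_163_add (h163 : PastenShimura2024_minimalDegree_le_163_mul)
    {W : WeierstrassCurve ℚ} [W.IsElliptic] [W.IsGloballyMinimal] [NeZero (W.conductorNorm ℤ)]
    (hW : Nonempty (ModularParametrizationData W (W.conductorNorm ℤ))) {B : ℝ}
    (hB : ∀ (W₀ : WeierstrassCurve ℚ) [W₀.IsElliptic]
      (D₀ : ModularParametrizationData W₀ (W.conductorNorm ℤ)),
      (∀ (W'' : WeierstrassCurve ℚ) [W''.IsElliptic]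
          (D'' : ModularParametrizationData W'' (W.conductorNorm ℤ)),
          D''.f = D₀.f → D₀.modularDegree ≤ D''.modularDegree) →
        Real.log (D₀.modularDegree : ℝ) ≤ B) :
    Real.log (minModularDegree W (W.conductorNorm ℤ) : ℝ) ≤ Real.log 163 + B := by
  obtain ⟨D', hD'min, hD'le⟩ := exists_minimal_datum hW
  obtain ⟨W₀, hW₀, D₀, hf, hmin⟩ := exists_minimal_datum_in_class D'
  have h1 : D'.modularDegree ≤ 163 * D₀.modularDegree :=
    h163 (W.conductorNorm ℤ) W₀ W D₀ D' hf.symm hmin hD'le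
  have hB₀ := hB W₀ D₀ hmin
  have hd₀ : (0 : ℝ) < D₀.modularDegree := by exact_mod_cast D₀.deg_pos
  have hd' : (0 : ℝ) < D'.modularDegree := by exact_mod_cast D'.deg_pos
  have h1' : (D'.modularDegree : ℝ) ≤ 163 * (D₀.modularDegree : ℝ) := by exact_mod_cast h1
  rw [← hD'min]
  calc Real.log (D'.modularDegree : ℝ)
      ≤ Real.log (163 * (D₀.modularDegree : ℝ)) := Real.log_le_log hd' h1'
    _ = Real.log 163 + Real.log (D₀.modularDegree : ℝ) :=
        Real.log_mul (by norm_num) hd₀.ne'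
    _ ≤ Real.log 163 + B := by linarith

end Pasten2024

open Pasten2024

/-- **Pasten, Thm 7.5 (explicit discriminant clause) from modularity, Mazur–Kenku and Thm 7.2
(explicit clause) in Pasten's `δ_{1,N}` form** — the §7.4 deduction "(EqDiscH) and (EqHDeg)
together with our bounds for `δ_{D,M}` specialized to `D = 1`, `M = N`": assuming
(i) modularity with an integral Manin constant (`nonempty_modularParametrizationData`),
(ii) the Mazur–Kenku comparison `minimal degree ≤ 163 · δ_{1,N}`
(`PastenShimura2024_minimalDegree_le_163_mul`), and (iii) `hδ`, the explicit clause of Thm 7.2,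
`log δ_{1,N} ≤ (N/12 + (7/12) d(N²)) (log N + 4 log N / log log N)`, with `δ_{1,N}` read — as in
`PastenShimura2024_thm_5_5` — as the modular degree of a datum of minimal degree among all data at
level `N`, of all elliptic `W'/ℚ`, with the same newform (Thm 7.2 is not vendored in the tree; see
`Pasten2024.log_modularDegree_le_of_thm_5_5` for its derivation from the vendored pieces), one gets
`pasten_thm_7_5_explicit`: `log|Δ_E| ≤ ½ (N + 7 d(N²)) (log N + 4 log N / log log N) + 124` for
every `E/ℚ`. The chain: `log|Δ_min| ≤ 6 log(minModularDegree) + (24π + 16 − 6 log π)` (sibling,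
proved from modularity: (EqDiscH) + Zagier + `c_f ∈ ℤ ∖ {0}` + trivial Petersson bound)
`≤ 6 log δ_{1,N} + 6 log 163 + 24π + 16 − 6 log π ≤ ½ (N + 7 d(N²))(…) + 124`, after passing to a
global minimal model. [cite: PastenShimura2024, Theorem 7.5 (proof, §7.4 p. 27, with §3 p. 13)] -/
theorem pasten_thm_7_5_explicit_of_modularity_of_degreeBound
    (hmod : nonempty_modularParametrizationData)
    (h163 : PastenShimura2024_minimalDegree_le_163_mul)
    (hδ : ∀ (N : ℕ) [NeZero N] (W : WeierstrassCurve ℚ) [W.IsElliptic]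
      (D : ModularParametrizationData W N),
      (∀ (W' : WeierstrassCurve ℚ) [W'.IsElliptic] (D' : ModularParametrizationData W' N),
          D'.f = D.f → D.modularDegree ≤ D'.modularDegree) →
        Real.log (D.modularDegree : ℝ) ≤
          ((N : ℝ) / 12 + 7 / 12 * ((N ^ 2).divisors.card : ℝ)) *
            (Real.log N + 4 * Real.log N / Real.log (Real.log N))) :
    pasten_thm_7_5_explicit := by
  intro W _
  -- pass to a global minimal model `C • W` (Néron; Silverman AEC VIII.8.3)
  obtain ⟨C, hC⟩ := hasGlobalMinimalModel_rat_holds W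
  haveI := hC
  have hN : (C • W).conductorNorm ℤ = W.conductorNorm ℤ := conductorNorm_smul_rat W C
  have hΔ : (C • W).minimalDiscriminantNorm ℤ = W.minimalDiscriminantNorm ℤ :=
    minimalDiscriminantNorm_smul_rat W C
  haveI : NeZero ((C • W).conductorNorm ℤ) := ⟨(conductorNorm_pos_holds (C • W)).ne'⟩
  have h1 := log_minimalDiscriminantNorm_le_of_modularity hmod (C • W)
  have h2 := log_minModularDegree_le_log_163_add h163 (hmod (C • W))
    (B := (((C • W).conductorNorm ℤ : ℝ) / 12 +
        7 / 12 * ((((C • W).conductorNorm ℤ) ^ 2).divisors.card : ℝ)) *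
      (Real.log ((C • W).conductorNorm ℤ) + 4 * Real.log ((C • W).conductorNorm ℤ) /
        Real.log (Real.log ((C • W).conductorNorm ℤ))))
    (fun W₀ _ D₀ hmin => hδ ((C • W).conductorNorm ℤ) W₀ D₀ hmin)
  have hc := six_log_163_add_const_le_124
  have key : Real.log ((C • W).minimalDiscriminantNorm ℤ : ℝ) ≤
      (1 / 2 : ℝ) * (((C • W).conductorNorm ℤ : ℝ) +
          7 * ((((C • W).conductorNorm ℤ) ^ 2).divisors.card : ℝ)) *
        (Real.log ((C • W).conductorNorm ℤ) + 4 * Real.log ((C • W).conductorNorm ℤ) /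
          Real.log (Real.log ((C • W).conductorNorm ℤ))) + 124 := by
    have e : ∀ a b c : ℝ, (1 / 2 : ℝ) * (a + 7 * b) * c = 6 * ((a / 12 + 7 / 12 * b) * c) :=
      fun a b c => by ring
    rw [e]
    linarith
  rw [hΔ, hN] at key
  exact key

/-- **Pasten, Thm 7.5 (explicit discriminant clause) from modularity, the vendored pieces of
Thm 7.2 and Deligne's bound.** Inputs: (i) `nonempty_modularParametrizationData` (modularity with
an integral Manin constant); (ii) `PastenShimura2024_minimalDegree_le_163_mul` (Mazur–Kenku, §3
p. 13); (iii) `PastenShimura2024_thm_5_5` (Thm 5.5, `δ_{1,N} ∣ ∏ η`); (iv)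
`Deligne1974_heckeT_eigenvalue_norm_le` (Deligne 1974, Thm 8.2 — its weight-`2` case, "the
Hasse-Weil bound on the Fourier coefficients of a normalized eigenform of weight `2`", is the only
unproved input of the displayed size bound of the proof of Thm 7.2, p. 26, `log η_{[χ₀]}(c) <
#c (log N + 4 log N / log log N)`, PROVED from it as
`PastenShimura2024_log_heckeCongruenceModulus_lt_of_deligne`); (v) `hr`, Prop 7.1 as used on p. 26,
`Σ_{c ≠ [χ₀]} #c ≤ N/12 + (7/12) d(N²)` (G. Martin's dimension bound; not in the tree). Of these
(i)–(iv) are named facts of the tree and only (v) and Thm 7.2 itself are un-vendored statements of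
the paper; nothing else of the printed proof of Thm 7.5 remains unproved.
[cite: PastenShimura2024, Theorem 7.5 (proof, §7.4 p. 27) with Thm 7.2 (proof, p. 26)]
[cite: Deligne1974, Thm. 8.2 (p. 302)] -/
theorem pasten_thm_7_5_explicit_of_modularity_of_thm_5_5
    (hmod : nonempty_modularParametrizationData)
    (h163 : PastenShimura2024_minimalDegree_le_163_mul)
    (h55 : PastenShimura2024_thm_5_5)
    (hDel : Deligne1974_heckeT_eigenvalue_norm_le)
    (hr : ∀ (N : ℕ) [NeZero N] (W : WeierstrassCurve ℚ) [W.IsElliptic]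
      (D : ModularParametrizationData W N),
      (∑ P ∈ (finite_minimalPrimes_anemicHeckeRing N 2).toFinset.erase (eigenIdeal D.f),
          (Module.finrank ℤ (anemicHeckeRing N 2 ⧸ P) : ℝ)) ≤
        (N : ℝ) / 12 + 7 / 12 * ((N ^ 2).divisors.card : ℝ)) :
    pasten_thm_7_5_explicit :=
  pasten_thm_7_5_explicit_of_modularity_of_degreeBound hmod h163
    fun _ _ _ _ D hmin => log_modularDegree_le_of_thm_5_5 h55
      (PastenShimura2024_log_heckeCongruenceModulus_lt_of_deligne hDel) hr D hmin


namespace Pasten2024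

/-- **Thm 7.2, explicit clause, with the Prop 7.1 slot `hr`, from Thm 5.5 and Deligne's bound**:
the composition used inside `pasten_thm_7_5_explicit_of_modularity_of_thm_5_5`, recorded as a
theorem of its own — for a datum `D` of minimal degree in its class at level `N`
(`D.modularDegree = δ_{1,N}`), `log δ_{1,N} ≤ (N/12 + (7/12) d(N²)) (log N + 4 log N / log log N)`
assuming `h55 : PastenShimura2024_thm_5_5`, `hDel : Deligne1974_heckeT_eigenvalue_norm_le` (whose
weight-`2` case gives the displayed size bound of the proof of Thm 7.2,
`PastenShimura2024_log_heckeCongruenceModulus_lt_of_deligne`) and Prop 7.1 as used on p. 26 (`hr`).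
[cite: PastenShimura2024, Thm. 7.2 (proof, p. 26)] [cite: Deligne1974, Thm. 8.2 (p. 302)] -/
theorem log_modularDegree_le_of_thm_5_5_of_deligne (h55 : PastenShimura2024_thm_5_5)
    (hDel : Deligne1974_heckeT_eigenvalue_norm_le)
    (hr : ∀ (N : ℕ) [NeZero N] (W : WeierstrassCurve ℚ) [W.IsElliptic]
      (D : ModularParametrizationData W N),
      (∑ P ∈ (finite_minimalPrimes_anemicHeckeRing N 2).toFinset.erase (eigenIdeal D.f),
          (Module.finrank ℤ (anemicHeckeRing N 2 ⧸ P) : ℝ)) ≤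
        (N : ℝ) / 12 + 7 / 12 * ((N ^ 2).divisors.card : ℝ))
    {W : WeierstrassCurve ℚ} {N : ℕ} [NeZero N] [W.IsElliptic] (D : ModularParametrizationData W N)
    (hmin : ∀ (W' : WeierstrassCurve ℚ) [W'.IsElliptic] (D' : ModularParametrizationData W' N),
      D'.f = D.f → D.modularDegree ≤ D'.modularDegree) :
    Real.log (D.modularDegree : ℝ) ≤
      ((N : ℝ) / 12 + 7 / 12 * ((N ^ 2).divisors.card : ℝ)) *
        (Real.log N + 4 * Real.log N / Real.log (Real.log N)) :=
  log_modularDegree_le_of_thm_5_5 h55 (PastenShimura2024_log_heckeCongruenceModulus_lt_of_deligne hDel)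
    hr D hmin

end Pasten2024

end Literature.NumberTheory.EllipticCurves

end
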